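import Summits.FinalStateConjecture.FinalStateConjecture.Theorems.SeamedChartsExhaust.Negative.KerrSchildTimeFunction
import Literature.Geometry.Lorentzian.KerrConvergence
import Literature.Geometry.Lorentzian.KerrConvergenceProofs
import HarnessLib

set_option linter.dupNamespace false

/-!
# `CaptureSufficesC2` (stmt-FinalStateConjecture-14986), line `Sketch`, Stub 4
# `stub_softShieldedDecomposition` — NEGATIVE LEMMA (typed gap B2, orientation direction):
# `ConvergesToKerr` holds VERBATIM on the time-reversed Kerr exterior, where exhaustion at every later
# chart time fails on the chart's own image

`Spacetime.ConvergesToKerr 𝒟oc M a k` (`KerrConvergence.lean`) has no time-orientation clause and,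
with `𝒟oc` existential, no coverage clause. Kernel-checked witness of the first defect: let `𝓢⁻` be
the Kerr–Schild patch `Kerr.spacetime M a r₊` (`{r > max r₊ 0}`, `M ≥ 0`, any `a`) with its time
orientation REVERSED (the white-hole exterior), and `Ψ := id`. Then

* `reversed_isLateEmbedding`, `reversed_deviationCk_eq_zero`, `reversed_convergesToKerr` — `Ψ` is a
  late-time embedding for the region `{t* > τ₀}` with deviation IDENTICALLY `0`, so
  `𝓢⁻.ConvergesToKerr {t* > τ₀} M a k` for every `k` and every `τ₀`;
* `reversed_not_exhaustive` — yet for every `τ₀ < τ₁` the exhaustion clause at chart time `τ₁`,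
  `{t* > τ₀} ∖ {t* > τ₁} ⊆ J⁻_{𝓢⁻}({t* = τ₁})`, FAILS: `J⁻_{𝓢⁻} = J⁺_{Kerr}` and Kerr–Schild time is
  a time function (`KerrTime.time_le_of_mem_causalFuture`), so no point with `t* < τ₁` lies in it.

Since clause (ii) of the summit's `HasExhaustiveCharts` for the `N = 1` decomposition built from a
chart `Ψ` is exactly this exhaustion (with `O ⊇ Ψ{t* > τ₀}`), no consumer of `BulkKerrCaptureC2` /
`CaptureAtC2` can assemble `HasExhaustiveCharts` from `ConvergesToKerr 𝒟oc M' a' 2` by bookkeeping: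
the chart's orientation (and, by the shifted-chart computation of ideator 2, its reach to the true
horizon) must come from elsewhere. No definitions, no named facts, no `sorry`.

References: M. Dafermos, I. Rodnianski, arXiv:0811.0354, §5.1 (`t*` is a time function in ingoing
Kerr–Schild coordinates); DHRT arXiv:2104.08222, §1 (consequence form of convergence, as vendored);
B. O'Neill, *Semi-Riemannian geometry* (1983), Ch. 14, p. 403 (time duality).
-/

noncomputable section

namespace Summit.FinalStateConjecture.FinalStateConjecture.Theorems.CaptureSufficesC2.Negative

open Set Filter Function Topology
open scoped Manifold ContDiff Topology
open Literature.Geometry.Lorentzian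
open Summit.FinalStateConjecture.FinalStateConjecture.Theorems.SeamedChartsExhaust.Negative

section Reversed

variable [Kerr.Facts]

/-- The Kerr–Schild patch `{r > max r₊ 0}` with its time orientation REVERSED (white-hole exterior). -/
local notation "𝓢⁻[" M ", " a ", " hM "]" =>
  (Spacetime.mk (Spacetime.toLorentzianManifold (Kerr.spacetime M a (Kerr.rPlus M a) hM))
    (TimeOrientation.reverse (Spacetime.timeOrientation (Kerr.spacetime M a (Kerr.rPlus M a) hM))) :
    Spacetime 4)

/-- The identity is a late-time embedding of the Kerr background, for the self-charted region
`{t* > τ₀}`, into the TIME-REVERSED Kerr–Schild patch `{r > max r₊ 0}` (smooth, open embedding of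
the open late region; both region clauses trivial). DHRT arXiv:2104.08222, §1 (field-by-field
reading of `IsLateEmbedding`). [cite: arXiv210408222, §1] -/
theorem reversed_isLateEmbedding (M a : ℝ) (hM : 0 ≤ M) (τ₀ : ℝ) :
    (𝓢⁻[M, a, hM]).IsLateEmbedding (Kerr.background M a)
      ((fun x ↦ x : (Kerr.background M a).domain → (𝓢⁻[M, a, hM]).carrier) ''
        Kerr.lateRegion M a τ₀) τ₀ (fun x ↦ x) := by
  have hopen : IsOpen (Kerr.lateRegion M a τ₀) :=
    isOpen_lt continuous_const ((PiLp.continuous_apply 2 _ 0).comp continuous_subtype_val)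
  exact ⟨⟨contMDiff_id, hopen.isOpenEmbedding_subtypeVal, subset_rfl⟩,
    fun _ hx ↦ (hx.2 hx.1).elim⟩

/-- On the time-reversed Kerr–Schild patch the identity chart has metric deviation IDENTICALLY
ZERO (the reversed spacetime has the same metric `g_{M,a}`; `pullbackBilin_id`), hence `Cᵏ`
deviation `0` on every slab, for every `k`. DHRT arXiv:2104.08222, §1. [cite: arXiv210408222, §1] -/
theorem reversed_deviationCk_eq_zero (M a : ℝ) (hM : 0 ≤ M) (k : ℕ) (τ : ℝ) :
    (𝓢⁻[M, a, hM]).deviationCk (Kerr.background M a) (fun x ↦ x) k τ = 0 := by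
  have hdev : ∀ x, (𝓢⁻[M, a, hM]).deviation (Kerr.background M a) (fun x ↦ x) x = 0 := by
    intro x
    -- `pullbackBilin id g = g` on the carrier; the deviation unfolds to `pullbackBilin id g x − g x`
    have key := congrFun (pullbackBilin_id (I := 𝓡 4) (𝓢⁻[M, a, hM]).metric.val) x
    exact sub_eq_zero.2 key
  have hext : (𝓢⁻[M, a, hM]).deviationExtend (Kerr.background M a) (fun x ↦ x) = 0 := by
    funext y
    by_cases hy : y ∈ (Kerr.background M a).domain
    · rw [show y = ((⟨y, hy⟩ : (Kerr.background M a).domain) : E4) from rfl,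
        Spacetime.deviationExtend_coe, hdev]
      rfl
    · rw [Spacetime.deviationExtend_of_not_mem _ _ _ hy]
      rfl
  unfold Spacetime.deviationCk
  rw [hext]
  exact supCkENorm_zero _ _

/-- **`ConvergesToKerr` on the white-hole exterior**: the time-reversed Kerr–Schild patch converges
to Kerr `(M, a)` in `Cᵏ`, for every `k`, in the sense of `Spacetime.ConvergesToKerr`, with region
`{t* > τ₀}` and the identity chart — although its chart time `t*` runs against the time
orientation. [cite: arXiv210408222, §1] -/
theorem reversed_convergesToKerr (M a : ℝ) (hM : 0 ≤ M) (τ₀ : ℝ) (k : ℕ) :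
    (𝓢⁻[M, a, hM]).ConvergesToKerr
      ((fun x ↦ x : (Kerr.background M a).domain → (𝓢⁻[M, a, hM]).carrier) ''
        Kerr.lateRegion M a τ₀) M a k := by
  refine ⟨τ₀, fun x ↦ x, reversed_isLateEmbedding M a hM τ₀, ?_⟩
  simp_rw [reversed_deviationCk_eq_zero]
  exact tendsto_const_nhds

/-- A point of the Kerr–Schild patch `{r > max r₀ 0}` with prescribed Kerr–Schild time `t`
(the patch is a product `ℝ × {r > max r₀ 0}`, nonempty by `Kerr.Facts.isConnected_region`).
[folklore] -/
theorem exists_mem_region_apply_zero_eq (a r₀ t : ℝ) : ∃ x ∈ Kerr.region a r₀, x 0 = t := by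
  obtain ⟨x₀, hx₀⟩ := (Kerr.Facts.isConnected_region a r₀).nonempty
  refine ⟨E4.ofTimeSpace t (E4.spatial x₀), ?_, E4.ofTimeSpace_apply_zero t _⟩
  have hx₀' : max r₀ 0 < Kerr.radius a x₀ := hx₀
  show max r₀ 0 < Kerr.radius a (E4.ofTimeSpace t (E4.spatial x₀))
  rwa [Kerr.radius_eq_of_spatial_eq a
    (show E4.spatial (E4.ofTimeSpace t (E4.spatial x₀)) = E4.spatial x₀ from
      E4.spatial_ofTimeSpace t _)]

/-- **Exhaustion at every later chart time FAILS for this `ConvergesToKerr` witness, on its own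
image**: for `τ₀ < τ₁` the points with `τ₀ < t* < τ₁` are charted (`∈ {t* > τ₀}`), not in
`{t* > τ₁}`, and not in `J⁻_{𝓢⁻}({t* = τ₁}) = J⁺_{Kerr}({t* = τ₁})`, because Kerr–Schild time is
non-decreasing along future causal curves of the Kerr orientation
(`KerrTime.time_le_of_mem_causalFuture`; Dafermos–Rodnianski arXiv:0811.0354, §5.1). This negates
clause (iii) of the strong package / clause (ii) of `HasExhaustiveCharts` for the `N = 1`
decomposition built from the chart. [cite: arXiv08110354, §5.1] -/
theorem reversed_not_exhaustive (M a : ℝ) (hM : 0 ≤ M) {τ₀ τ₁ : ℝ} (h : τ₀ < τ₁) :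
    ¬ ((fun x ↦ x : (Kerr.background M a).domain → (𝓢⁻[M, a, hM]).carrier) ''
          Kerr.lateRegion M a τ₀ \
        (fun x ↦ x : (Kerr.background M a).domain → (𝓢⁻[M, a, hM]).carrier) ''
          Kerr.lateRegion M a τ₁ ⊆
      (𝓢⁻[M, a, hM]).metric.causalPast (𝓢⁻[M, a, hM]).timeOrientation
        ((fun x ↦ x : (Kerr.background M a).domain → (𝓢⁻[M, a, hM]).carrier) ''
          Kerr.timeSlab M a τ₁)) := by
  intro hsub
  obtain ⟨x, hx, hxt⟩ := exists_mem_region_apply_zero_eq a (Kerr.rPlus M a) ((τ₀ + τ₁) / 2)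
  set p : (Kerr.spacetime M a (Kerr.rPlus M a) hM).carrier := ⟨x, hx⟩ with hp
  have hp0 : p.1 0 = (τ₀ + τ₁) / 2 := hxt
  have hmem : p ∈ (fun x ↦ x : (Kerr.background M a).domain → (𝓢⁻[M, a, hM]).carrier) ''
        Kerr.lateRegion M a τ₀ \
      (fun x ↦ x : (Kerr.background M a).domain → (𝓢⁻[M, a, hM]).carrier) ''
        Kerr.lateRegion M a τ₁ := by
    refine ⟨⟨p, ?_, rfl⟩, ?_⟩
    · show τ₀ < p.1 0
      rw [hp0]; linarith
    · rintro ⟨q, hq, hqp⟩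
      have hq' : τ₁ < q.1 0 := hq
      have hqp0 : q.1 0 = p.1 0 := by rw [← hqp]
      rw [hqp0, hp0] at hq'
      linarith
  have hJ := hsub hmem
  -- `J⁻` of the reversed orientation is `J⁺` of the Kerr orientation
  change p ∈ (Kerr.spacetime M a (Kerr.rPlus M a) hM).metric.causalPast
    (Kerr.spacetime M a (Kerr.rPlus M a) hM).timeOrientation.reverse
    ((fun x ↦ x : (Kerr.background M a).domain → (𝓢⁻[M, a, hM]).carrier) ''
      Kerr.timeSlab M a τ₁) at hJ
  rw [LorentzianMetric.causalPast_reverse, LorentzianMetric.causalFuture_eq_biUnion] at hJ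
  obtain ⟨q, ⟨q', hq', hq'q⟩, hpq⟩ := mem_iUnion₂.mp hJ
  have hle := KerrTime.time_le_of_mem_causalFuture hpq
  have hq0 : q.1 0 = τ₁ := by rw [← hq'q]; exact hq'
  rw [hq0, hp0] at hle
  linarith

/-- **Summary (B2, orientation direction).** For every `M ≥ 0`, `a` and `τ₀ < τ₁` there are a
spacetime `𝓢` (the time-reversed Kerr exterior) and a chart `Ψ` with `𝓢.ConvergesToKerr
(Ψ{t* > τ₀}) M a k` for EVERY `k` (indeed a late-time embedding with identically vanishing
deviation), for which exhaustion at chart time `τ₁` fails on the chart's own image — so the capture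
conclusion `∃ 𝒟oc, ConvergesToKerr 𝒟oc M' a' 2` cannot by itself yield the summit's
`HasExhaustiveCharts`. [cite: arXiv08110354, §5.1] -/
theorem exists_convergesToKerr_not_exhaustive (M a : ℝ) (hM : 0 ≤ M) {τ₀ τ₁ : ℝ} (h : τ₀ < τ₁) :
    ∃ (𝓢 : Spacetime.{0} 4) (Ψ : (Kerr.background M a).domain → 𝓢.carrier),
      (∀ k : ℕ, 𝓢.ConvergesToKerr (Ψ '' Kerr.lateRegion M a τ₀) M a k) ∧
      (∀ k : ℕ, 𝓢.IsLateEmbedding (Kerr.background M a) (Ψ '' Kerr.lateRegion M a τ₀) τ₀ Ψ ∧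
        ∀ τ : ℝ, 𝓢.deviationCk (Kerr.background M a) Ψ k τ = 0) ∧
      ¬ (Ψ '' Kerr.lateRegion M a τ₀ \ Ψ '' Kerr.lateRegion M a τ₁ ⊆
          𝓢.metric.causalPast 𝓢.timeOrientation (Ψ '' Kerr.timeSlab M a τ₁)) :=
  ⟨𝓢⁻[M, a, hM], fun x ↦ x, fun k ↦ reversed_convergesToKerr M a hM τ₀ k,
    fun k ↦ ⟨reversed_isLateEmbedding M a hM τ₀, reversed_deviationCk_eq_zero M a hM k⟩,
    reversed_not_exhaustive M a hM h⟩

end Reversed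

/-- **Registered sub-stub `stub_softShieldedDecomposition_orientationWitness`** (negative side of
Stub 4, typed gap B2, orientation direction; = `exists_convergesToKerr_not_exhaustive` in closed
`∀`-form): for every `M ≥ 0`, `a`, `τ₀ < τ₁` there are a spacetime and a chart converging to Kerr
`(M, a)` in every `Cᵏ` in the sense of `ConvergesToKerr` (a late-time embedding with identically
vanishing deviation) whose exhaustion at chart time `τ₁` fails on its own image.
[cite: arXiv08110354, §5.1] -/
theorem stub_softShieldedDecomposition_orientationWitness : ∀ [Kerr.Facts] (M a : ℝ), 0 ≤ M → ∀ (τ₀ τ₁ : ℝ), τ₀ < τ₁ → ∃ (𝓢 : Spacetime.{0} 4) (Ψ : (Kerr.background M a).domain → 𝓢.carrier), (∀ k : ℕ, 𝓢.ConvergesToKerr (Ψ '' Kerr.lateRegion M a τ₀) M a k) ∧ (∀ k : ℕ, 𝓢.IsLateEmbedding (Kerr.background M a) (Ψ '' Kerr.lateRegion M a τ₀) τ₀ Ψ ∧ ∀ τ : ℝ, 𝓢.deviationCk (Kerr.background M a) Ψ k τ = 0) ∧ ¬ (Ψ '' Kerr.lateRegion M a τ₀ \ Ψ '' Kerr.lateRegion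 M a τ₁ ⊆ 𝓢.metric.causalPast 𝓢.timeOrientation (Ψ '' Kerr.timeSlab M a τ₁)) :=
  fun M a hM _ _ h ↦ exists_convergesToKerr_not_exhaustive M a hM h

end Summit.FinalStateConjecture.FinalStateConjecture.Theorems.CaptureSufficesC2.Negative

end
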